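import Summits.BirchSwinnertonDyer.BirchSwinnertonDyer.Theorems.SchneiderFreeAdditiveX3UpperCoSocketOfFlatHalves
import Summits.BirchSwinnertonDyer.BirchSwinnertonDyer.Theorems.SchneiderFreeAdditiveX3LogOmegaConjugatePrime
import Summits.BirchSwinnertonDyer.BirchSwinnertonDyer.Theorems.SchneiderFreeAdditiveX3GordTwoBranchIMCOfKY
import HarnessLib

/-!
# Route `SchneiderFreeAdditiveX3Upper` (K1 wing), co-cruxes `GordTwoBranchCoIMCField` (20365) / `PotMultBranchCoIMC` (20366):
# the ♭-socket of the UPPER half with the frame at the CONJUGATE prime — `(Q) ⊆ Ch_Λ(X_ac^∅ strict at 𝔭)·𝓞_{ℂ_p}⟦T⟧` for a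
# ♭-frame `Q` of `f_E` at `(ι′, 𝔭̄)`, i.e. Keller–Yin's convention

Cell `bsd-schneider-ideate`, seat `bsd-schneider-door-c5` (prover, generation 19; assembly layer).  PARTITION: board row
B6 ∩ X3 ∩ sst-twist, `r = 1`, of `Rank1Residual.partition` — the WING (upper half); types-the-object-of nothing new; closes none
of B6's cells.  bears_on: K1-wing (route-BirchSwinnertonDyer-SchneiderFreeAdditiveX3Upper items 20365 / 20366; FINDING-door-c5-g19 §2).

Sequel of `…UpperCoSocketOfFlatHalves` (p634154: the upper ♭-socket with the frame at `(ι′, 𝔭)` against `X_ac^∅` strict at `𝔭`).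
Keller–Yin Thm. 3.5.1 in branch currency (`thm351_charIdeal_eq_branch_OPEN`) puts the branch `𝓛_v` at the prime `v` induced by the
embedding datum and the Selmer group strict at `v̄`; a MATCHED Keller–Yin frame ((M1) `rankinSelbergValueHecke_genusTwist_eq`,
p633239; (M2) the local form of the `p`-adic avatar at `v ∣ p`, not in the tree) therefore delivers the CO-divisibility
`(Q) ⊆ Ch_Λ(X_ac^∅ at 𝔭)·𝓞_{ℂ_p}⟦T⟧` for a frame at the CONJUGATE prime `𝔭̄`.  The upper socket only reads `ord_p` of constant
terms, and in rank one `(log_{ω,𝔭̄} P)² = (log_{ω,𝔭} P)²` (`sq_logOmega_embAt_eq_of_rank_one`), so p634154's proof re-runs with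
Hsieh's frame and Liu–Zhang–Zhang's UNIT value taken at `(ι′, 𝔭̄)` (`exists_conjugate_degreeOne`) and the logarithm moved to `𝔭`:

* §1 `additiveIMCUpperBDPInputManinAt_of_kolyvagin_of_hsieh_of_lzz_of_intCoDivConj` — the class-wide upper socket on a pair of the
  cell from Kolyvagin, Hsieh 2014 Thm A (any level), LZZ 2018 (additive) and H3♭ᵒᵖᶜ: for every degree-one `𝔭̄ ≠ 𝔭` above `p`, every
  `ι′` inducing `𝔭̄` and every ♭-frame `Q` of `Dt.f` at `(ι′, 𝔭̄)`: `(Q) ⊆ Ch_Λ(X_ac^∅ at 𝔭)·𝓞_{ℂ_p}⟦T⟧`.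
* §2 the wing's two co-cruxes BY NAME from H3♭ᵒᵖᶜ (`…_of_intCoDivConj`) and §3 from its ∃-frame form (`…_of_exists_intCoDivConj`,
  x11b3 rigidity via `span_le_ideal_of_exists_frame`, p634154) — the exact output shape of «KY3-branch (iii) + CHx + MATCH».

HONEST FRAMING: THEOREMS ONLY (no definition, no named fact, no `sorry`); pure composition of tree theorems; CONDITIONAL on the
displayed hypotheses (on (M) nothing is in print; on (G-ord) Keller–Yin is a PREPRINT and the matching is not in the tree);
nothing is closed; BSD is proved for no curve; «closes rung: none».
References: [JetchevSkinnerWan2017] §7.4.1; [Hsieh2014] Thm. A; [LiuZhangZhang2018] Thm 1.5.1/1.5.3; [Castella2018] Thm. 3.1;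
[KellerYin2024b] arXiv:2410.23241 Def. 3.4.1, Thm. 3.5.1 (preprint; conventions); [SilvermanAEC2009] VIII.6.7, IV.6.4.
-/

set_option autoImplicit false
-- `Summit.<P>.<Sub>` repeats `BirchSwinnertonDyer` by the tree's layout convention (D-0017)
set_option linter.dupNamespace false

noncomputable section

open scoped Classical NumberField

open Field NumberField IsDedekindDomain WeierstrassCurve PowerSeries
  Literature.NumberTheory.EllipticCurves Literature.NumberTheory.EllipticCurves.GreenbergSelmer
  Literature.NumberTheory.GaloisRepresentations Literature.NumberTheory.GaloisCohomology
  Literature.NumberTheory.EllipticCurves.ModularForms Literature.NumberTheory.EllipticCurves.Rank1Residual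
  Summit.BirchSwinnertonDyer.Rank1Residual Summit.BirchSwinnertonDyer.Rank1Residual.X11b
  Summit.BirchSwinnertonDyer.Rank1Residual.X11b.AcSelmer Summit.BirchSwinnertonDyer.Rank1Residual.X11b.Halves
  Summit.BirchSwinnertonDyer.Rank1Residual.X11b.CongruenceLimit
  Summit.BirchSwinnertonDyer.BirchSwinnertonDyer.Theorems.SchneiderFree
  Summit.BirchSwinnertonDyer.BirchSwinnertonDyer.Theorems.SchneiderFree.Upper
  Summit.BirchSwinnertonDyer.BirchSwinnertonDyer.Theses.SchneiderFreeAdditiveX3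

open Summit.BirchSwinnertonDyer.BirchSwinnertonDyer.Theses.SchneiderFreeAdditiveX3Upper
  (GordTwoBranchCoIMCField PotMultBranchCoIMC)

namespace Summit.BirchSwinnertonDyer.BirchSwinnertonDyer.Theorems.SchneiderFreeAdditiveX3.ControlDischarged

/-! ### §1 The upper socket from two refereed inputs and the ♭-co-divisibility -/

/-- **The UPPER socket `Upper.AdditiveIMCUpperBDPInputManinAt W p` from Kolyvagin, Hsieh (any level), LZZ (additive) and the
♭-CO-DIVISIBILITY AT THE CONJUGATE PRIME only** (`p ≠ 2`, `ClassX3 W p`, `SubSemistableTwist W p`; Poitou–Tate (i) is the tree theorem behind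
`pt_selmer_forall`).  For every datum of the socket and every frame `(κ, γ, 𝔭)`: CTL₀ gives `n` with `Ch_Λ(X_ac^∅) = (f)`,
`ord_p f(0) = n`; `ι′` induces `𝔭`; Hsieh gives a ♭-frame `Q` of `Dt.f`; LZZ pins `Q(0) = u·(log_ω P / c)²` with `‖u‖ = 1`; the displayed
co-divisibility puts `Q` in `(f)·𝓞_{ℂ_p}⟦T⟧`; norms give `‖log_ω P / c‖² = ‖Q(0)‖ ≤ ‖f(0)‖`, i.e. `n + 2·v_p(c) ≤ 2·ord_p log_ω P`.
p634154's proof with Hsieh's frame / LZZ's value at `(ι′, 𝔭̄)` and `(log_{𝔭̄} P)² = (log_𝔭 P)²` (rank one, Kolyvagin).  CONDITIONAL on `hKo`, `hA`, `hL`, `hCoDiv`; nothing asserted about any curve.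
[cite: SilvermanAEC2009, VIII.6.7 and IV.6.4]
[cite: JetchevSkinnerWan2017, §7.4.1 (arXiv:1512.06894 p. 30)] [cite: Hsieh2014, Thm. A p. 712 (Doc. Math. 19)]
[cite: LiuZhangZhang2018, Thm 1.5.1 and Thm 1.5.3 (Duke Math. J. 167 pp. 748–749)] -/
theorem additiveIMCUpperBDPInputManinAt_of_kolyvagin_of_hsieh_of_lzz_of_intCoDivConj
    (hKo : ∀ (N : ℕ) [NeZero N] (W : WeierstrassCurve ℚ) (K : Type) [Field K] [NumberField K],
      Literature.NumberTheory.EllipticCurves.kolyvagin N W K)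
    (hA : Hsieh2014.thmA_exists_isHsiehLFunction_unrPeriod_anyLevel)
    (hL : LiuZhangZhang2018.thm151_thm153_modularCurve_heegnerVector_additive)
    {W : WeierstrassCurve ℚ} [W.IsElliptic] [W.IsGloballyMinimal] {p : ℕ} [Fact p.Prime]
    (hp2 : p ≠ 2) (hX : ClassX3 W p) (hS : Additive.SubSemistableTwist W p)
    (hCoDiv : ∀ (N : ℕ) [NeZero N] (K : Type) [Field K] [NumberField K]
      (Dt : ModularParametrizationData W N) (H : HeegnerDatum N (NumberField.discr K)) (ι : K →+* ℂ)
      (P : (W.baseChange K).toAffine.Point),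
      W.analyticRank = 1 → Additive.N10.Locus W p → W.conductorNorm ℤ = N → IsImaginaryQuadratic K →
      Odd (NumberField.discr K) → ¬ p ∣ Units.torsionOrder K → SatisfiesHeegnerHypothesis N K →
      (W.quadraticTwist (NumberField.discr K : ℚ)).entireLFunction 1 ≠ 0 →
      WeierstrassCurve.Affine.Point.map ι.toRatAlgHom P = heegnerPointComplex Dt H →
      ¬ IsOfFinAddOrder P → (∀ Q : (W.baseChange K).toAffine.Point, p • Q = 0 → Q = 0) →
      ∀ (κ : ZpExtension K p), κ.IsAnticyclotomic →
        ∀ (γ : Field.absoluteGaloisGroup K) [Fact (κ.IsTopGenerator γ)]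
          (𝔭 : HeightOneSpectrum (𝓞 K)), ((p : ℕ) : 𝓞 K) ∈ 𝔭.asIdeal →
          𝔭.asIdeal.ramificationIdx (𝓞 ℚ) = 1 → 𝔭.asIdeal.inertiaDeg (𝓞 ℚ) = 1 →
          ∀ (𝔮 : HeightOneSpectrum (𝓞 K)), ((p : ℕ) : 𝓞 K) ∈ 𝔮.asIdeal → 𝔭 ≠ 𝔮 →
            𝔮.asIdeal.ramificationIdx (𝓞 ℚ) = 1 → 𝔮.asIdeal.inertiaDeg (𝓞 ℚ) = 1 →
            ∀ (ι' : PadicAlgCl p ≃+* ℂ), BranchInducesPrime p ι' 𝔮 →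
              ∀ (ΩK : ℂ) (Ωp : ℂ_[p]) (Q : PowerSeries (PadicComplexInt p)), ΩK ≠ 0 → Ωp ≠ 0 →
                R1.IsBDPLFunctionInt p ι' 𝔮 κ γ Dt.f ΩK Ωp Q →
                  Ideal.span {Q} ≤
                    (XAc.charIdeal (W.baseChange K) p κ 𝔭 ∅ γ).map (PowerSeries.map (R1.toCpInt p))) :
    Upper.AdditiveIMCUpperBDPInputManinAt W p := by
  intro N _ K _ _ Dt H ι P hr' hloc hN hK hodd hunit hHe hL1 hP hnt hnoT κ hκ γ _ 𝔭 h𝔭 he hf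
  have hp : p.Prime := Fact.out
  have hγ : κ.IsTopGenerator γ := Fact.out
  -- CTL₀: the characteristic ideal is principal with `ord_p f(0) = n`
  obtain ⟨n, hn⟩ := exists_hasCharValuationAt_of_pt_of_kolyvagin pt_selmer_forall hKo W p hr' hp2 hX hS N K Dt H ι P
    hr' hloc hN hK hodd hunit hHe hL1 hP hnt κ hκ γ 𝔭 h𝔭 he hf
  -- `p² ∣ N`
  have haddv : Addv W p := hloc.2.1
  have hp2N : p ^ 2 ∣ N := by
    by_contra h
    rw [← hN] at h
    rcases hasGoodReductionAtPrime_or_hasMultiplicativeReductionAtPrime_of_not_sq_dvd_conductorNorm (V := W) h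
      with hg | hm
    · exact haddv.1 hg
    · exact haddv.2 hm
  have hpN : p ∣ N := dvd_trans (dvd_pow_self p two_ne_zero) hp2N
  have hsplit : ((Ideal.span {(p : ℤ)}).primesOver (𝓞 K)).ncard = 2 := hHe p hp hpN
  -- the conjugate degree-one prime `𝔮 = 𝔭̄`, an embedding datum inducing it, Hsieh's frame there
  obtain ⟨𝔮, h𝔮, hne, he', hf'⟩ := exists_conjugate_degreeOne hK.1 h𝔭 he hf
  obtain ⟨ι₀⟩ := PadicAlgCl.nonempty_ringEquiv_complex p
  obtain ⟨ι', -, hι'⟩ := exists_datum_forall_mem_iff p ι₀ hK h𝔮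
  obtain ⟨lam, rlam, hlu, hinfl, hAQ, hunrl, havl, hfacl⟩ := lambdaSupplyAt hp2 ι' K κ hK hκ
  subst hN
  -- rank one over `K` (Kolyvagin), for the `𝔭 ↔ 𝔭̄` symmetry of `log_ω P`
  have hrk : (W.baseChange K).mordellWeilRank = 1 := (hKo _ W K hK hHe ⟨Dt, H, ι, hP⟩ hnt).1
  obtain ⟨A, ΩK₀, C, Ωp, Q₀, hA0, hΩK₀, hC, hQ₀⟩ :=
    hA ι' K 𝔮 κ γ Dt.f lam rlam hp2 Dt.isNewformOf.1 hK hsplit h𝔮 hι' hHe hlu hinfl hAQ hunrl havl hfacl hκ hγ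
  obtain ⟨ΩK, c, hΩK, -, hQ⟩ :=
    exists_isBDPLFunctionInt_of_isHsiehLFunction ι' 𝔮 κ γ Dt.f hpN hA0 hΩK₀ hC ((Ωp : unrIntegers p) : ℂ_[p]) hQ₀
  have hΩp : ((Ωp : unrIntegers p) : ℂ_[p]) ≠ 0 := fun h0 ↦ by
    have h1 := norm_coe_units_unrIntegers p Ωp
    rw [h0, norm_zero] at h1
    exact zero_ne_one h1
  set Q : PowerSeries (PadicComplexInt p) := PowerSeries.C c * Q₀ with hQdef
  -- the value of the frame at `𝟙` (LZZ at `𝔭̄`, `‖u‖ = 1`), its logarithm moved to `𝔭`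
  obtain ⟨u, hu, hval'⟩ :=
    UniversalToricDescentWaldspurgerFlat.intSeries_value_of_frame_tors hL W K 𝔮 κ γ Dt H ι P Dt.f Dt.isNewformOf
      hp2 rfl hp2N hK hunit h𝔮 he' hf' hHe hκ hP hnt ι' hι' hΩK hΩp hQ
  set x : ℚ_[p] := logOmega W p (embAt K p 𝔭 h𝔭 he hf) P / (Dt.c : ℚ_[p]) with hx
  have hval : IntSeries.HasValueAt Q 0 (u * (algebraMap ℚ_[p] ℂ_[p] x) ^ 2) := by
    have hsq := sq_logOmega_embAt_eq_of_rank_one W p hK.1 hrk h𝔭 he hf h𝔮 he' hf' P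
    have hx2 : (logOmega W p (embAt K p 𝔮 h𝔮 he' hf') P / (Dt.c : ℚ_[p])) ^ 2 = x ^ 2 := by
      rw [hx, div_pow, div_pow, hsq]
    rw [← map_pow, ← hx2, map_pow]
    exact hval'
  -- the ♭-co-divisibility at this frame
  have hcodiv := hCoDiv (W.conductorNorm ℤ) K Dt H ι P hr' hloc rfl hK hodd hunit hHe hL1 hP hnt hnoT κ hκ γ 𝔭 h𝔭 he hf
    𝔮 h𝔮 hne he' hf' ι' hι' ΩK _ Q hΩK hΩp hQ
  -- the upper norm half over `𝓞_{ℂ_p}⟦T⟧`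
  obtain ⟨htors, f, hfI, hf0, hfn⟩ := hn
  have hmem : Q ∈ Ideal.span {PowerSeries.map (R1.toCpInt p) f} := by
    have h3 := hcodiv
    rw [hfI, map_span_singleton_powerSeries] at h3
    exact (Ideal.span_singleton_le_iff_mem _).mp h3
  have hQ0 : u * (algebraMap ℚ_[p] ℂ_[p] x) ^ 2 = ((constantCoeff Q : PadicComplexInt p) : ℂ_[p]) :=
    R1.intSeries_eq_constantCoeff_of_hasValueAt_zero p hval
  obtain ⟨G, hG⟩ := Ideal.mem_span_singleton'.mp hmem
  have hfac : ((constantCoeff Q : PadicComplexInt p) : ℂ_[p]) =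
      ((constantCoeff G : PadicComplexInt p) : ℂ_[p]) * algebraMap ℚ_[p] ℂ_[p] ((constantCoeff f : ℤ_[p]) : ℚ_[p]) := by
    rw [← R1.coe_toCpInt, ← constantCoeff_map_apply (R1.toCpInt p) f, ← hG, map_mul, MulMemClass.coe_mul]
  have hp1 : (1 : ℝ) < p := by exact_mod_cast hp.one_lt
  have hnormf : ‖x‖ ^ 2 ≤ ‖((constantCoeff f : ℤ_[p]) : ℚ_[p])‖ := by
    calc ‖x‖ ^ 2
        = ‖u‖ * ‖algebraMap ℚ_[p] ℂ_[p] x‖ ^ 2 := by rw [hu, one_mul, norm_algebraMap']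
      _ = ‖((constantCoeff Q : PadicComplexInt p) : ℂ_[p])‖ := by rw [← hQ0, norm_mul, norm_pow]
      _ = ‖((constantCoeff G : PadicComplexInt p) : ℂ_[p])‖ *
            ‖algebraMap ℚ_[p] ℂ_[p] ((constantCoeff f : ℤ_[p]) : ℚ_[p])‖ := by rw [hfac, norm_mul]
      _ ≤ 1 * ‖algebraMap ℚ_[p] ℂ_[p] ((constantCoeff f : ℤ_[p]) : ℚ_[p])‖ :=
          mul_le_mul_of_nonneg_right (R1.norm_coe_padicComplexInt_le_one p _) (norm_nonneg _)
      _ = ‖((constantCoeff f : ℤ_[p]) : ℚ_[p])‖ := by rw [one_mul, norm_algebraMap']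
  -- `x ≠ 0`
  have hlog : logOmega W p (embAt K p 𝔭 h𝔭 he hf) P ≠ 0 := R1.logOmega_ne_zero W p _ hnt
  have hc0 : Dt.c ≠ 0 := Dt.maninConstant_ne_zero_holds
  have hc0' : (Dt.c : ℚ_[p]) ≠ 0 := by exact_mod_cast hc0
  have hx0 : x ≠ 0 := div_ne_zero hlog hc0'
  -- norms to valuations: `ord_p f(0) = n ≤ 2·ord_p x`
  rw [← PadicInt.norm_def, PadicInt.norm_eq_zpow_neg_valuation hf0, Padic.norm_eq_zpow_neg_valuation hx0] at hnormf
  have hlhs : ((p : ℝ) ^ (-x.valuation)) ^ 2 = (p : ℝ) ^ (-(2 * x.valuation)) := by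
    rw [← zpow_natCast ((p : ℝ) ^ (-x.valuation)) 2, ← zpow_mul]
    congr 1
    push_cast
    ring
  rw [hlhs, zpow_le_zpow_iff_right₀ hp1] at hnormf
  have hle : ((constantCoeff f).valuation : ℤ) ≤ 2 * x.valuation := by omega
  rw [hx, div_eq_mul_inv, Padic.valuation_mul hlog (inv_ne_zero hc0'), Padic.valuation_inv,
    Padic.valuation_intCast, valuation_logOmega hlog, hfn] at hle
  refine ⟨n, ⟨htors, f, hfI, hf0, hfn⟩, ?_⟩
  simp only [padicValInt] at hle
  linarith

/-! ### §2 The wing's two co-cruxes by name -/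

/-- **Wing crux r4 `PotMultBranchCoIMC` (item 20366) ⇐ Kolyvagin ∧ Hsieh 2014 Thm. A (any level) ∧ Liu–Zhang–Zhang 2018 (additive) ∧
H3♭ᵒᵖ on the (M) cell** (the co-divisibility at every ♭-frame, displayed hypothesis `hM`; the crux's rational-line binder is not
used).  CONDITIONAL; on (M) no divisibility is in print. [cite: Hsieh2014, Thm. A p. 712 (Doc. Math. 19)]
[cite: LiuZhangZhang2018, Thm 1.5.1 and Thm 1.5.3 (Duke Math. J. 167 pp. 748–749)]
[cite: KellerYin2024b, §3.1 Case II (arXiv:2410.23241 pp. 13–15) (scope statement only)] -/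
theorem potMultBranchCoIMC_of_kolyvagin_of_hsieh_of_lzz_of_intCoDivConj
    (hKo : ∀ (N : ℕ) [NeZero N] (W : WeierstrassCurve ℚ) (K : Type) [Field K] [NumberField K],
      Literature.NumberTheory.EllipticCurves.kolyvagin N W K)
    (hA : Hsieh2014.thmA_exists_isHsiehLFunction_unrPeriod_anyLevel)
    (hL : LiuZhangZhang2018.thm151_thm153_modularCurve_heegnerVector_additive)
    (hM : ∀ (W : WeierstrassCurve ℚ) [W.IsElliptic] [W.IsGloballyMinimal] (p : ℕ) [Fact p.Prime],
      p ≠ 2 → ClassX3 W p → Additive.SubM W p →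
      ∀ (N : ℕ) [NeZero N] (K : Type) [Field K] [NumberField K]
        (Dt : ModularParametrizationData W N) (H : HeegnerDatum N (NumberField.discr K)) (ι : K →+* ℂ)
        (P : (W.baseChange K).toAffine.Point),
        W.analyticRank = 1 → Additive.N10.Locus W p → W.conductorNorm ℤ = N → IsImaginaryQuadratic K →
        Odd (NumberField.discr K) → ¬ p ∣ Units.torsionOrder K → SatisfiesHeegnerHypothesis N K →
        (W.quadraticTwist (NumberField.discr K : ℚ)).entireLFunction 1 ≠ 0 →
        WeierstrassCurve.Affine.Point.map ι.toRatAlgHom P = heegnerPointComplex Dt H →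
        ¬ IsOfFinAddOrder P → (∀ Q : (W.baseChange K).toAffine.Point, p • Q = 0 → Q = 0) →
        ∀ (κ : ZpExtension K p), κ.IsAnticyclotomic →
          ∀ (γ : Field.absoluteGaloisGroup K) [Fact (κ.IsTopGenerator γ)]
            (𝔭 : HeightOneSpectrum (𝓞 K)), ((p : ℕ) : 𝓞 K) ∈ 𝔭.asIdeal →
            𝔭.asIdeal.ramificationIdx (𝓞 ℚ) = 1 → 𝔭.asIdeal.inertiaDeg (𝓞 ℚ) = 1 →
            ∀ (𝔮 : HeightOneSpectrum (𝓞 K)), ((p : ℕ) : 𝓞 K) ∈ 𝔮.asIdeal → 𝔭 ≠ 𝔮 →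
              𝔮.asIdeal.ramificationIdx (𝓞 ℚ) = 1 → 𝔮.asIdeal.inertiaDeg (𝓞 ℚ) = 1 →
              ∀ (ι' : PadicAlgCl p ≃+* ℂ), BranchInducesPrime p ι' 𝔮 →
                ∀ (ΩK : ℂ) (Ωp : ℂ_[p]) (Q : PowerSeries (PadicComplexInt p)), ΩK ≠ 0 → Ωp ≠ 0 →
                  R1.IsBDPLFunctionInt p ι' 𝔮 κ γ Dt.f ΩK Ωp Q →
                    Ideal.span {Q} ≤
                      (XAc.charIdeal (W.baseChange K) p κ 𝔭 ∅ γ).map (PowerSeries.map (R1.toCpInt p))) :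
    PotMultBranchCoIMC := by
  intro W _ _ p _ hp2 hX hSM _
  exact additiveIMCUpperBDPInputManinAt_of_kolyvagin_of_hsieh_of_lzz_of_intCoDivConj hKo hA hL hp2 hX (Or.inl hSM)
    (hM W p hp2 hX hSM)

/-- **Wing crux r3 `GordTwoBranchCoIMCField` (item 20365) ⇐ Kolyvagin ∧ Hsieh 2014 Thm. A (any level) ∧ Liu–Zhang–Zhang 2018
(additive) ∧ H3♭ᵒᵖ on the (G-ord, `e = 2`) cell** (displayed hypothesis `hG`; the crux's rational-line and `d_K ≠ −3` binders are
not used — LZZ's value needs neither).  Its co-divisibility is Keller–Yin Thm. 3.5.1 (iii) (PREPRINT) read at a MATCHED frame of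
`f_E` (the matching is NOT in the tree, FINDING-door-c5-g19 §2).  CONDITIONAL; nothing closed.
[cite: Hsieh2014, Thm. A p. 712 (Doc. Math. 19)] [cite: LiuZhangZhang2018, Thm 1.5.1 and Thm 1.5.3 (Duke Math. J. 167 pp. 748–749)]
[cite: KellerYin2024b, Thm. 3.5.1 (arXiv:2410.23241 p. 20) (shape; preprint)] -/
theorem gordTwoBranchCoIMCField_of_kolyvagin_of_hsieh_of_lzz_of_intCoDivConj
    (hKo : ∀ (N : ℕ) [NeZero N] (W : WeierstrassCurve ℚ) (K : Type) [Field K] [NumberField K],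
      Literature.NumberTheory.EllipticCurves.kolyvagin N W K)
    (hA : Hsieh2014.thmA_exists_isHsiehLFunction_unrPeriod_anyLevel)
    (hL : LiuZhangZhang2018.thm151_thm153_modularCurve_heegnerVector_additive)
    (hG : ∀ (W : WeierstrassCurve ℚ) [W.IsElliptic] [W.IsGloballyMinimal] (p : ℕ) [Fact p.Prime],
      p ≠ 2 → ClassX3 W p → Additive.SubGordTwo W p →
      ∀ (N : ℕ) [NeZero N] (K : Type) [Field K] [NumberField K]
        (Dt : ModularParametrizationData W N) (H : HeegnerDatum N (NumberField.discr K)) (ι : K →+* ℂ)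
        (P : (W.baseChange K).toAffine.Point),
        W.analyticRank = 1 → Additive.N10.Locus W p → W.conductorNorm ℤ = N → IsImaginaryQuadratic K →
        Odd (NumberField.discr K) → ¬ p ∣ Units.torsionOrder K → SatisfiesHeegnerHypothesis N K →
        (W.quadraticTwist (NumberField.discr K : ℚ)).entireLFunction 1 ≠ 0 →
        WeierstrassCurve.Affine.Point.map ι.toRatAlgHom P = heegnerPointComplex Dt H →
        ¬ IsOfFinAddOrder P → (∀ Q : (W.baseChange K).toAffine.Point, p • Q = 0 → Q = 0) →
        ∀ (κ : ZpExtension K p), κ.IsAnticyclotomic →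
          ∀ (γ : Field.absoluteGaloisGroup K) [Fact (κ.IsTopGenerator γ)]
            (𝔭 : HeightOneSpectrum (𝓞 K)), ((p : ℕ) : 𝓞 K) ∈ 𝔭.asIdeal →
            𝔭.asIdeal.ramificationIdx (𝓞 ℚ) = 1 → 𝔭.asIdeal.inertiaDeg (𝓞 ℚ) = 1 →
            ∀ (𝔮 : HeightOneSpectrum (𝓞 K)), ((p : ℕ) : 𝓞 K) ∈ 𝔮.asIdeal → 𝔭 ≠ 𝔮 →
              𝔮.asIdeal.ramificationIdx (𝓞 ℚ) = 1 → 𝔮.asIdeal.inertiaDeg (𝓞 ℚ) = 1 →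
              ∀ (ι' : PadicAlgCl p ≃+* ℂ), BranchInducesPrime p ι' 𝔮 →
                ∀ (ΩK : ℂ) (Ωp : ℂ_[p]) (Q : PowerSeries (PadicComplexInt p)), ΩK ≠ 0 → Ωp ≠ 0 →
                  R1.IsBDPLFunctionInt p ι' 𝔮 κ γ Dt.f ΩK Ωp Q →
                    Ideal.span {Q} ≤
                      (XAc.charIdeal (W.baseChange K) p κ 𝔭 ∅ γ).map (PowerSeries.map (R1.toCpInt p))) :
    GordTwoBranchCoIMCField := by
  intro W _ _ p _ hp2 hX hSG _ K _ _ _ _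
  exact additiveIMCUpperBDPInputManinAtField_of_inputManinAt
    (additiveIMCUpperBDPInputManinAt_of_kolyvagin_of_hsieh_of_lzz_of_intCoDivConj hKo hA hL hp2 hX (Or.inr hSG)
      (hG W p hp2 hX hSG)) K

/-! ### §3 The ∃-frame forms (one ♭-frame per datum) -/

/-- **H3♭ᵒᵖᶜ ⇐ H3♭ᵒᵖᶜ∃ on any cell (frames at the conjugate prime).** Over the binders of the upper socket restricted to a cell predicate `Cell W p`: if at every
datum and every `ι′` inducing `𝔭` there is ONE ♭-frame `Q₀` (non-zero periods) with `(Q₀) ⊆ Ch_Λ(X_ac^∅)·𝓞_{ℂ_p}⟦T⟧`, then the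
co-divisibility holds at EVERY ♭-frame — the hypothesis `hM` / `hG` of §2 VERBATIM.  Conditional; nothing asserted about any curve.
[cite: Castella2018, Thm. 3.1 (arXiv:1704.06608 p. 9)] [cite: JetchevSkinnerWan2017, §7.4.1 (arXiv:1512.06894 p. 30) (socket shape)] -/
theorem intCoDivConj_of_exists_frame
    (Cell : ∀ (W : WeierstrassCurve ℚ) [W.IsElliptic] [W.IsGloballyMinimal] (p : ℕ) [Fact p.Prime], Prop)
    (hEx : ∀ (W : WeierstrassCurve ℚ) [W.IsElliptic] [W.IsGloballyMinimal] (p : ℕ) [Fact p.Prime],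
      p ≠ 2 → ClassX3 W p → Cell W p →
      ∀ (N : ℕ) [NeZero N] (K : Type) [Field K] [NumberField K]
        (Dt : ModularParametrizationData W N) (H : HeegnerDatum N (NumberField.discr K)) (ι : K →+* ℂ)
        (P : (W.baseChange K).toAffine.Point),
        W.analyticRank = 1 → Additive.N10.Locus W p → W.conductorNorm ℤ = N → IsImaginaryQuadratic K →
        Odd (NumberField.discr K) → ¬ p ∣ Units.torsionOrder K → SatisfiesHeegnerHypothesis N K →
        (W.quadraticTwist (NumberField.discr K : ℚ)).entireLFunction 1 ≠ 0 →
        WeierstrassCurve.Affine.Point.map ι.toRatAlgHom P = heegnerPointComplex Dt H →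
        ¬ IsOfFinAddOrder P → (∀ Q : (W.baseChange K).toAffine.Point, p • Q = 0 → Q = 0) →
        ∀ (κ : ZpExtension K p), κ.IsAnticyclotomic →
          ∀ (γ : Field.absoluteGaloisGroup K) [Fact (κ.IsTopGenerator γ)]
            (𝔭 : HeightOneSpectrum (𝓞 K)), ((p : ℕ) : 𝓞 K) ∈ 𝔭.asIdeal →
            𝔭.asIdeal.ramificationIdx (𝓞 ℚ) = 1 → 𝔭.asIdeal.inertiaDeg (𝓞 ℚ) = 1 →
            ∀ (𝔮 : HeightOneSpectrum (𝓞 K)), ((p : ℕ) : 𝓞 K) ∈ 𝔮.asIdeal → 𝔭 ≠ 𝔮 →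
              𝔮.asIdeal.ramificationIdx (𝓞 ℚ) = 1 → 𝔮.asIdeal.inertiaDeg (𝓞 ℚ) = 1 →
              ∀ (ι' : PadicAlgCl p ≃+* ℂ), BranchInducesPrime p ι' 𝔮 →
                ∃ (ΩK : ℂ) (Ωp : ℂ_[p]) (Q : PowerSeries (PadicComplexInt p)), ΩK ≠ 0 ∧ Ωp ≠ 0 ∧
                  R1.IsBDPLFunctionInt p ι' 𝔮 κ γ Dt.f ΩK Ωp Q ∧
                    Ideal.span {Q} ≤
                      (XAc.charIdeal (W.baseChange K) p κ 𝔭 ∅ γ).map (PowerSeries.map (R1.toCpInt p))) :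
    ∀ (W : WeierstrassCurve ℚ) [W.IsElliptic] [W.IsGloballyMinimal] (p : ℕ) [Fact p.Prime],
      p ≠ 2 → ClassX3 W p → Cell W p →
      ∀ (N : ℕ) [NeZero N] (K : Type) [Field K] [NumberField K]
        (Dt : ModularParametrizationData W N) (H : HeegnerDatum N (NumberField.discr K)) (ι : K →+* ℂ)
        (P : (W.baseChange K).toAffine.Point),
        W.analyticRank = 1 → Additive.N10.Locus W p → W.conductorNorm ℤ = N → IsImaginaryQuadratic K →
        Odd (NumberField.discr K) → ¬ p ∣ Units.torsionOrder K → SatisfiesHeegnerHypothesis N K →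
        (W.quadraticTwist (NumberField.discr K : ℚ)).entireLFunction 1 ≠ 0 →
        WeierstrassCurve.Affine.Point.map ι.toRatAlgHom P = heegnerPointComplex Dt H →
        ¬ IsOfFinAddOrder P → (∀ Q : (W.baseChange K).toAffine.Point, p • Q = 0 → Q = 0) →
        ∀ (κ : ZpExtension K p), κ.IsAnticyclotomic →
          ∀ (γ : Field.absoluteGaloisGroup K) [Fact (κ.IsTopGenerator γ)]
            (𝔭 : HeightOneSpectrum (𝓞 K)), ((p : ℕ) : 𝓞 K) ∈ 𝔭.asIdeal →
            𝔭.asIdeal.ramificationIdx (𝓞 ℚ) = 1 → 𝔭.asIdeal.inertiaDeg (𝓞 ℚ) = 1 →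
            ∀ (𝔮 : HeightOneSpectrum (𝓞 K)), ((p : ℕ) : 𝓞 K) ∈ 𝔮.asIdeal → 𝔭 ≠ 𝔮 →
              𝔮.asIdeal.ramificationIdx (𝓞 ℚ) = 1 → 𝔮.asIdeal.inertiaDeg (𝓞 ℚ) = 1 →
              ∀ (ι' : PadicAlgCl p ≃+* ℂ), BranchInducesPrime p ι' 𝔮 →
                ∀ (ΩK : ℂ) (Ωp : ℂ_[p]) (Q : PowerSeries (PadicComplexInt p)), ΩK ≠ 0 → Ωp ≠ 0 →
                  R1.IsBDPLFunctionInt p ι' 𝔮 κ γ Dt.f ΩK Ωp Q →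
                    Ideal.span {Q} ≤
                      (XAc.charIdeal (W.baseChange K) p κ 𝔭 ∅ γ).map (PowerSeries.map (R1.toCpInt p)) := by
  intro W _ _ p _ hp2 hX hC N _ K _ _ Dt H ι P hr' hloc hN hK hodd hunit hHe hL1 hP hnt hnoT κ hκ γ hγ 𝔭 h𝔭 he hf
    𝔮 h𝔮 hne he' hf' ι' hι' ΩK Ωp Q hΩK hΩp hQ
  exact span_le_ideal_of_exists_frame hp2 hK hκ hγ.out
    (hEx W p hp2 hX hC N K Dt H ι P hr' hloc hN hK hodd hunit hHe hL1 hP hnt hnoT κ hκ γ 𝔭 h𝔭 he hf 𝔮 h𝔮 hne he' hf' ι' hι')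
    hΩK hΩp hQ

/-- **Wing crux r4 `PotMultBranchCoIMC` ⇐ Kolyvagin ∧ Hsieh ∧ LZZ ∧ H3♭ᵒᵖ∃ on the (M) cell** (ONE ♭-frame per datum with the
co-divisibility): §3 with `Cell := Additive.SubM` fed to §2. CONDITIONAL; on (M) no divisibility is in print.
[cite: Hsieh2014, Thm. A p. 712 (Doc. Math. 19)] [cite: LiuZhangZhang2018, Thm 1.5.1 and Thm 1.5.3 (Duke Math. J. 167 pp. 748–749)] -/
theorem potMultBranchCoIMC_of_kolyvagin_of_hsieh_of_lzz_of_exists_intCoDivConj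
    (hKo : ∀ (N : ℕ) [NeZero N] (W : WeierstrassCurve ℚ) (K : Type) [Field K] [NumberField K],
      Literature.NumberTheory.EllipticCurves.kolyvagin N W K)
    (hA : Hsieh2014.thmA_exists_isHsiehLFunction_unrPeriod_anyLevel)
    (hL : LiuZhangZhang2018.thm151_thm153_modularCurve_heegnerVector_additive)
    (hM : ∀ (W : WeierstrassCurve ℚ) [W.IsElliptic] [W.IsGloballyMinimal] (p : ℕ) [Fact p.Prime],
      p ≠ 2 → ClassX3 W p → Additive.SubM W p →
      ∀ (N : ℕ) [NeZero N] (K : Type) [Field K] [NumberField K]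
        (Dt : ModularParametrizationData W N) (H : HeegnerDatum N (NumberField.discr K)) (ι : K →+* ℂ)
        (P : (W.baseChange K).toAffine.Point),
        W.analyticRank = 1 → Additive.N10.Locus W p → W.conductorNorm ℤ = N → IsImaginaryQuadratic K →
        Odd (NumberField.discr K) → ¬ p ∣ Units.torsionOrder K → SatisfiesHeegnerHypothesis N K →
        (W.quadraticTwist (NumberField.discr K : ℚ)).entireLFunction 1 ≠ 0 →
        WeierstrassCurve.Affine.Point.map ι.toRatAlgHom P = heegnerPointComplex Dt H →
        ¬ IsOfFinAddOrder P → (∀ Q : (W.baseChange K).toAffine.Point, p • Q = 0 → Q = 0) →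
        ∀ (κ : ZpExtension K p), κ.IsAnticyclotomic →
          ∀ (γ : Field.absoluteGaloisGroup K) [Fact (κ.IsTopGenerator γ)]
            (𝔭 : HeightOneSpectrum (𝓞 K)), ((p : ℕ) : 𝓞 K) ∈ 𝔭.asIdeal →
            𝔭.asIdeal.ramificationIdx (𝓞 ℚ) = 1 → 𝔭.asIdeal.inertiaDeg (𝓞 ℚ) = 1 →
            ∀ (𝔮 : HeightOneSpectrum (𝓞 K)), ((p : ℕ) : 𝓞 K) ∈ 𝔮.asIdeal → 𝔭 ≠ 𝔮 →
              𝔮.asIdeal.ramificationIdx (𝓞 ℚ) = 1 → 𝔮.asIdeal.inertiaDeg (𝓞 ℚ) = 1 →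
              ∀ (ι' : PadicAlgCl p ≃+* ℂ), BranchInducesPrime p ι' 𝔮 →
                ∃ (ΩK : ℂ) (Ωp : ℂ_[p]) (Q : PowerSeries (PadicComplexInt p)), ΩK ≠ 0 ∧ Ωp ≠ 0 ∧
                  R1.IsBDPLFunctionInt p ι' 𝔮 κ γ Dt.f ΩK Ωp Q ∧
                    Ideal.span {Q} ≤
                      (XAc.charIdeal (W.baseChange K) p κ 𝔭 ∅ γ).map (PowerSeries.map (R1.toCpInt p))) :
    PotMultBranchCoIMC :=
  potMultBranchCoIMC_of_kolyvagin_of_hsieh_of_lzz_of_intCoDivConj hKo hA hL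
    (intCoDivConj_of_exists_frame (fun W _ _ p _ => Additive.SubM W p) hM)

/-- **Wing crux r3 `GordTwoBranchCoIMCField` ⇐ Kolyvagin ∧ Hsieh ∧ LZZ ∧ H3♭ᵒᵖ∃ on the (G-ord, `e = 2`) cell** (ONE ♭-frame per datum
with the co-divisibility — the shape a MATCHED Keller–Yin branch frame would deliver): §3 with `Cell := Additive.SubGordTwo` fed to
§2. CONDITIONAL; nothing closed. [cite: Hsieh2014, Thm. A p. 712 (Doc. Math. 19)]
[cite: LiuZhangZhang2018, Thm 1.5.1 and Thm 1.5.3 (Duke Math. J. 167 pp. 748–749)]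
[cite: KellerYin2024b, Thm. 3.5.1 (arXiv:2410.23241 p. 20) (shape; preprint)] -/
theorem gordTwoBranchCoIMCField_of_kolyvagin_of_hsieh_of_lzz_of_exists_intCoDivConj
    (hKo : ∀ (N : ℕ) [NeZero N] (W : WeierstrassCurve ℚ) (K : Type) [Field K] [NumberField K],
      Literature.NumberTheory.EllipticCurves.kolyvagin N W K)
    (hA : Hsieh2014.thmA_exists_isHsiehLFunction_unrPeriod_anyLevel)
    (hL : LiuZhangZhang2018.thm151_thm153_modularCurve_heegnerVector_additive)
    (hG : ∀ (W : WeierstrassCurve ℚ) [W.IsElliptic] [W.IsGloballyMinimal] (p : ℕ) [Fact p.Prime],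
      p ≠ 2 → ClassX3 W p → Additive.SubGordTwo W p →
      ∀ (N : ℕ) [NeZero N] (K : Type) [Field K] [NumberField K]
        (Dt : ModularParametrizationData W N) (H : HeegnerDatum N (NumberField.discr K)) (ι : K →+* ℂ)
        (P : (W.baseChange K).toAffine.Point),
        W.analyticRank = 1 → Additive.N10.Locus W p → W.conductorNorm ℤ = N → IsImaginaryQuadratic K →
        Odd (NumberField.discr K) → ¬ p ∣ Units.torsionOrder K → SatisfiesHeegnerHypothesis N K →
        (W.quadraticTwist (NumberField.discr K : ℚ)).entireLFunction 1 ≠ 0 →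
        WeierstrassCurve.Affine.Point.map ι.toRatAlgHom P = heegnerPointComplex Dt H →
        ¬ IsOfFinAddOrder P → (∀ Q : (W.baseChange K).toAffine.Point, p • Q = 0 → Q = 0) →
        ∀ (κ : ZpExtension K p), κ.IsAnticyclotomic →
          ∀ (γ : Field.absoluteGaloisGroup K) [Fact (κ.IsTopGenerator γ)]
            (𝔭 : HeightOneSpectrum (𝓞 K)), ((p : ℕ) : 𝓞 K) ∈ 𝔭.asIdeal →
            𝔭.asIdeal.ramificationIdx (𝓞 ℚ) = 1 → 𝔭.asIdeal.inertiaDeg (𝓞 ℚ) = 1 →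
            ∀ (𝔮 : HeightOneSpectrum (𝓞 K)), ((p : ℕ) : 𝓞 K) ∈ 𝔮.asIdeal → 𝔭 ≠ 𝔮 →
              𝔮.asIdeal.ramificationIdx (𝓞 ℚ) = 1 → 𝔮.asIdeal.inertiaDeg (𝓞 ℚ) = 1 →
              ∀ (ι' : PadicAlgCl p ≃+* ℂ), BranchInducesPrime p ι' 𝔮 →
                ∃ (ΩK : ℂ) (Ωp : ℂ_[p]) (Q : PowerSeries (PadicComplexInt p)), ΩK ≠ 0 ∧ Ωp ≠ 0 ∧
                  R1.IsBDPLFunctionInt p ι' 𝔮 κ γ Dt.f ΩK Ωp Q ∧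
                    Ideal.span {Q} ≤
                      (XAc.charIdeal (W.baseChange K) p κ 𝔭 ∅ γ).map (PowerSeries.map (R1.toCpInt p))) :
    GordTwoBranchCoIMCField :=
  gordTwoBranchCoIMCField_of_kolyvagin_of_hsieh_of_lzz_of_intCoDivConj hKo hA hL
    (intCoDivConj_of_exists_frame (fun W _ _ p _ => Additive.SubGordTwo W p) hG)

end Summit.BirchSwinnertonDyer.BirchSwinnertonDyer.Theorems.SchneiderFreeAdditiveX3.ControlDischarged

end
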